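import Literature.Probability.RandomPlanarGeometry.LoewnerDriverStability
import Mathlib.Topology.UniformSpace.LocallyUniformConvergence
import HarnessLib

/-!
# Uniform stability of the Loewner maps in the driving function (Kemppainen–Smirnov, Lemma 5.4)

Topic `Literature/Probability/RandomPlanarGeometry`; theorems only (deterministic Loewner
calculus, no definition, no named fact). A. Kemppainen, S. Smirnov, *Random curves, scaling
limits and Loewner evolutions*, Ann. Probab. 45 (2017) 698–779, Appendix A, Lemma 5.4 (arXiv
1212.6215v3 numbering, p. 31): "Let `W_n`, `W` be continuous on `[0, T]` and let `g_{n,t}`, `g_t`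
be the solutions of the Loewner equation with the driving terms `W_n`, `W`. If `W_n → W`
uniformly, then `g_{n,t} → g_t` uniformly on `S_K(T, δ)` [points `δ`-away from the hull] and
`g_t` and `W` satisfy the Loewner equation" — "this lemma follows from the basic properties of
ordinary differential equations". It is one of the two limit lemmas (with the kernel convergence
Lemma 5.3) behind KS's "main lemma" 5.5 identifying the Loewner chain of a limit of curves, hence
behind Thm. 1.5 / Cor. 1.7 (the curve `lim γ_n` is driven by `lim W_n`), the input (J′) of the
identification step of Chelkak–Duminil-Copin–Hongler–Kemppainen–Smirnov, C. R. Math. 352 (2014),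
§3 (`InterfaceSLELimitData.lean`); cf. Lawler (2005), §4.7, Prop. 4.47.

The tree's `LoewnerDriverStability.lean` proves the POINTWISE two-driver tube estimate
(`Loewner.dist_map_le_of_driving_close`: one point `z`, flowing `δ`-away from `W` on `[0, b]`).
This file makes it UNIFORM on compact sets of flowing points, which is the form Lemma 5.4 is
used in:

* `Loewner.exists_forall_le_norm_map_sub_driving` — for `K` compact with `b < T_z` on `K` there
  is ONE `δ > 0` with `‖g_s(z) - W_s‖ ≥ δ` for all `z ∈ K`, `s ≤ b` (each trajectory stays away
  from the driving function, `IsSolution.exists_le_norm_sub`; nearby starting points have nearby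
  trajectories, `IsSolution.exists_forall_dist_lt`; finite subcover);
* `Loewner.exists_forall_dist_map_le_of_driving_close` — **uniform continuity in the driver**:
  for every `ε > 0` there is `η > 0` such that every continuous `W'` with `|W - W'| ≤ η` on
  `[0, b]` has `b < T_z^{W'}` and `‖g'_s(z) - g_s(z)‖ ≤ ε` for all `z ∈ K`, `s ≤ b`;
* `Loewner.tendstoUniformlyOn_map_of_tendstoUniformlyOn_driving` — **KS Lemma 5.4**: if
  `W_n → W` uniformly on `[0, b]` (any filter), then eventually every `z ∈ K` flows beyond `b`
  for `W_n` (in particular `K` misses the hulls `K^{W_n}_b`, `eventually_disjoint_hull`), and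
  `(s, z) ↦ g^{W_n}_s(z)` converges to `(s, z) ↦ g_s(z)` uniformly on `[0, b] × K`; the locally
  uniform form on the open set `{z | b < T_z}` of points flowing beyond `b`
  (`isOpen_setOf_lt_swallowingTime`) is `tendstoLocallyUniformlyOn_map_of_tendstoUniformlyOn_driving`.

(The clause "`g_t` and `W` satisfy the Loewner equation" of Lemma 5.4 is the definition of the
tree's `Loewner.map`.) Points of KS's `S_K(T, δ)` off the closed hull flow beyond `T`; the
statements here are phrased with the primitive flowing condition `b < T_z` of `LoewnerChain.lean`,
which covers real points as well.

## References

* A. Kemppainen, S. Smirnov, Ann. Probab. 45 (2017) 698–779, Appendix A, Lemma 5.4 (and its use in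
  Lemma 5.5). [KemppainenSmirnov2017]
* G. F. Lawler, *Conformally Invariant Processes in the Plane*, AMS (2005), §4.7, Prop. 4.47.
  [Lawler2005]
-/

noncomputable section

namespace Literature.Probability.RandomPlanarGeometry

namespace Loewner

open Set Filter Metric Topology
open scoped NNReal

variable {W : ℝ≥0 → ℝ}

/-! ### One tube radius for a compact set of flowing points -/

/-- **Trajectories from a compact set of flowing points stay uniformly away from the driving
function**: if `K` is compact and every `z ∈ K` flows beyond `b` (`b < T_z`), there is `δ > 0` with
`‖g_s(z) - W_s‖ ≥ δ` for all `z ∈ K` and `s ≤ b`. (Each trajectory is `δ_z`-away from `W` on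
`[0, b]`; trajectories from a small ball around `z` are `δ_z/2`-close to it; finite subcover.)
[cite: KemppainenSmirnov2017, App. A, Lemma 5.4 (proof: "basic properties of ODEs")] -/
theorem exists_forall_le_norm_map_sub_driving (hW : Continuous W) {b : ℝ≥0} {K : Set ℂ}
    (hK : IsCompact K) (hKb : ∀ z ∈ K, (b : WithTop ℝ≥0) < swallowingTime W z) :
    ∃ δ : ℝ≥0, 0 < δ ∧ ∀ z ∈ K, ∀ s : ℝ≥0, s ≤ b → (δ : ℝ) ≤ ‖map W s z - W s‖ := by
  classical
  -- local data: a ball and a radius of separation valid on it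
  have hdata : ∀ z ∈ K, ∃ ρ > (0 : ℝ), ∃ δ : ℝ≥0, 0 < δ ∧
      ∀ z' : ℂ, dist z' z < ρ → ∀ s : ℝ≥0, s ≤ b → (δ : ℝ) ≤ ‖map W s z' - W s‖ := by
    intro z hz
    have hzT := hKb z hz
    obtain ⟨g, hg⟩ := exists_isSolution_swallowingTime_holds hW (ne_driving_of_lt_swallowingTime hzT)
    have hbT' : (((b : ℝ)).toNNReal : WithTop ℝ≥0) < swallowingTime W z := by
      rwa [Real.toNNReal_coe]
    obtain ⟨δ, hδ, hfar⟩ := hg.exists_le_norm_sub hW b.coe_nonneg hbT'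
    have hδ2 : (0 : ℝ) < δ / 2 := half_pos (NNReal.coe_pos.2 hδ)
    obtain ⟨ρ, hρ, hclose⟩ := hg.exists_forall_dist_lt hW hzT hδ2
    refine ⟨ρ, hρ, δ / 2, half_pos hδ, fun z' hz' s hs ↦ ?_⟩
    obtain ⟨hz'T, hsol⟩ := hclose z' hz'
    obtain ⟨h, hh⟩ := exists_isSolution_swallowingTime_holds hW (ne_driving_of_lt_swallowingTime hz'T)
    have hsT' : (s : WithTop ℝ≥0) < swallowingTime W z' := lt_of_le_of_lt (WithTop.coe_le_coe.2 hs) hz'T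
    rw [map_eq_of_isSolution hW hh hsT']
    have h1 : dist (h s) (g s) < δ / 2 :=
      hsol h _ hh s s.coe_nonneg (NNReal.coe_le_coe.2 hs) (by rw [Real.toNNReal_coe]; exact hsT')
    have h2 : (δ : ℝ) ≤ ‖g s - W ((s : ℝ).toNNReal)‖ := hfar s ⟨s.coe_nonneg, NNReal.coe_le_coe.2 hs⟩
    rw [Real.toNNReal_coe] at h2
    have h3 : ‖g s - (W s : ℂ)‖ ≤ ‖h s - g s‖ + ‖h s - (W s : ℂ)‖ := by
      calc ‖g s - (W s : ℂ)‖ ≤ ‖g s - h s‖ + ‖h s - (W s : ℂ)‖ :=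
            norm_sub_le_norm_sub_add_norm_sub _ _ _
        _ = ‖h s - g s‖ + ‖h s - (W s : ℂ)‖ := by rw [norm_sub_rev (g s)]
    rw [dist_eq_norm] at h1
    have h4 : ((δ / 2 : ℝ≥0) : ℝ) = δ - δ / 2 := by push_cast; ring
    rw [h4]
    linarith
  choose! ρ hρ δ hδ hgood using hdata
  -- a finite subcover
  obtain ⟨tf, htf⟩ := hK.elim_finite_subcover (fun z : K ↦ ball (z : ℂ) (ρ z))
    (fun _ ↦ isOpen_ball) (fun z hz ↦ mem_iUnion.2 ⟨⟨z, hz⟩, mem_ball_self (hρ z hz)⟩)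
  by_cases hne : tf.Nonempty
  · refine ⟨tf.inf' hne (fun z ↦ δ z), (Finset.lt_inf'_iff hne).2 fun z _ ↦ hδ z z.2, ?_⟩
    intro z hz s hs
    obtain ⟨i, hi, hzi⟩ : ∃ i ∈ tf, z ∈ ball ((i : K) : ℂ) (ρ i) := by
      have := htf hz
      simpa only [mem_iUnion, exists_prop] using this
    refine le_trans ?_ (hgood i i.2 z hzi s hs)
    exact NNReal.coe_le_coe.2 (Finset.inf'_le (fun z : K ↦ δ (z : ℂ)) hi)
  · -- `K` is empty
    refine ⟨1, one_pos, fun z hz ↦ ?_⟩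
    exfalso
    rw [Finset.not_nonempty_iff_eq_empty] at hne
    have := htf hz
    rw [hne] at this
    simp at this

/-! ### Uniform continuity of the Loewner maps in the driving function -/

/-- **The Loewner maps depend continuously on the driving function, uniformly up to time `b` on a
compact set of flowing points.** For `K` compact with `b < T_z^{W}` on `K` and `ε > 0` there is
`η > 0` such that for every continuous `W'` with `|W_s - W'_s| ≤ η` for `s ≤ b`: every `z ∈ K`
flows beyond `b` for `W'`, and `‖g^{W'}_s(z) - g^{W}_s(z)‖ ≤ ε` for all `s ≤ b`. (The pointwise
tube estimate `dist_map_le_of_driving_close` with the uniform radius of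
`exists_forall_le_norm_map_sub_driving`: `‖g' - g‖ ≤ η (e^{8s/δ²} - 1)`.)
[cite: KemppainenSmirnov2017, App. A, Lemma 5.4] [cite: Lawler2005, §4.7 Prop. 4.47] -/
theorem exists_forall_dist_map_le_of_driving_close (hW : Continuous W) {b : ℝ≥0} {K : Set ℂ}
    (hK : IsCompact K) (hKb : ∀ z ∈ K, (b : WithTop ℝ≥0) < swallowingTime W z) {ε : ℝ}
    (hε : 0 < ε) :
    ∃ η > (0 : ℝ), ∀ W' : ℝ≥0 → ℝ, Continuous W' → (∀ s : ℝ≥0, s ≤ b → |W s - W' s| ≤ η) →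
      ∀ z ∈ K, (b : WithTop ℝ≥0) < swallowingTime W' z ∧
        ∀ s : ℝ≥0, s ≤ b → dist (map W' s z) (map W s z) ≤ ε := by
  obtain ⟨δ, hδ, hfar⟩ := exists_forall_le_norm_map_sub_driving hW hK hKb
  have hδ' : (0 : ℝ) < δ := NNReal.coe_pos.2 hδ
  set C : ℝ := Real.exp (2 / ((δ : ℝ) / 2) ^ 2 * b) with hC
  have hC1 : 1 ≤ C := Real.one_le_exp (by positivity)
  have hC0 : 0 < C := lt_of_lt_of_le one_pos hC1
  set η : ℝ := min ((δ : ℝ) / 8) (ε / 2) / C with hη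
  have hm0 : 0 < min ((δ : ℝ) / 8) (ε / 2) := lt_min (by positivity) (half_pos hε)
  have hη0 : 0 < η := div_pos hm0 hC0
  have hηC : η * C = min ((δ : ℝ) / 8) (ε / 2) := by
    rw [hη]; field_simp
  have hηle : η ≤ min ((δ : ℝ) / 8) (ε / 2) := by
    calc η = η * 1 := (mul_one η).symm
      _ ≤ η * C := mul_le_mul_of_nonneg_left hC1 hη0.le
      _ = _ := hηC
  have hηδ : η ≤ δ / 4 := by
    have := (hηle.trans (min_le_left _ _))
    linarith
  refine ⟨η, hη0, fun W' hW' hWW' z hz ↦ ?_⟩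
  have hsmall : dist z z * Real.exp (2 / ((δ : ℝ) / 2) ^ 2 * b) +
      η * (Real.exp (2 / ((δ : ℝ) / 2) ^ 2 * b) - 1) < δ / 4 := by
    rw [dist_self, zero_mul, zero_add, ← hC]
    calc η * (C - 1) ≤ η * C := by nlinarith
      _ = min ((δ : ℝ) / 8) (ε / 2) := hηC
      _ ≤ (δ : ℝ) / 8 := min_le_left _ _
      _ < δ / 4 := by linarith
  obtain ⟨hzT', hdist⟩ := dist_map_le_of_driving_close (z' := z) hW hW' (hKb z hz) hδ
    (hfar z hz) hη0.le hηδ hWW' hsmall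
  refine ⟨hzT', fun s hs ↦ (hdist s hs).trans ?_⟩
  rw [dist_self, zero_mul, zero_add]
  have hexp : Real.exp (2 / ((δ : ℝ) / 2) ^ 2 * s) ≤ C := by
    rw [hC]
    exact Real.exp_le_exp.2 (mul_le_mul_of_nonneg_left (NNReal.coe_le_coe.2 hs) (by positivity))
  calc η * (Real.exp (2 / ((δ : ℝ) / 2) ^ 2 * s) - 1) ≤ η * C := by nlinarith
    _ = min ((δ : ℝ) / 8) (ε / 2) := hηC
    _ ≤ ε / 2 := min_le_right _ _
    _ ≤ ε := by linarith

/-! ### KS Lemma 5.4: uniform driver convergence ⟹ uniform convergence of the maps -/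

section Tendsto

variable {ι : Type*} {l : Filter ι} {Wn : ι → ℝ≥0 → ℝ} {b : ℝ≥0} {K : Set ℂ}

/-- **Kemppainen–Smirnov, Lemma 5.4 (flowing beyond `b` is stable).** If `W_n → W` uniformly on
`[0, b]` along a filter (all continuous), then eventually every point of a compact set `K` of
points flowing beyond `b` for `W` flows beyond `b` for `W_n`.
[cite: KemppainenSmirnov2017, App. A, Lemma 5.4] -/
theorem eventually_forall_lt_swallowingTime_of_tendstoUniformlyOn_driving (hW : Continuous W)
    (hWn : ∀ᶠ n in l, Continuous (Wn n))
    (hconv : TendstoUniformlyOn (fun n (s : ℝ≥0) ↦ Wn n s) W l (Iic b))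
    (hK : IsCompact K) (hKb : ∀ z ∈ K, (b : WithTop ℝ≥0) < swallowingTime W z) :
    ∀ᶠ n in l, ∀ z ∈ K, (b : WithTop ℝ≥0) < swallowingTime (Wn n) z := by
  obtain ⟨η, hη, hgood⟩ := exists_forall_dist_map_le_of_driving_close hW hK hKb one_pos
  have h1 := (Metric.tendstoUniformlyOn_iff.1 hconv) η hη
  filter_upwards [hWn, h1] with n hn hn'
  exact fun z hz ↦ (hgood (Wn n) hn (fun s hs ↦ by
    have := hn' s hs
    rw [Real.dist_eq] at this
    exact this.le) z hz).1

/-- Under the same hypotheses, eventually `K` misses the hulls `K^{W_n}_b` (points flowing beyond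
`b` are not swallowed by time `b`). [cite: KemppainenSmirnov2017, App. A, Lemma 5.4] -/
theorem eventually_disjoint_hull_of_tendstoUniformlyOn_driving (hW : Continuous W)
    (hWn : ∀ᶠ n in l, Continuous (Wn n))
    (hconv : TendstoUniformlyOn (fun n (s : ℝ≥0) ↦ Wn n s) W l (Iic b))
    (hK : IsCompact K) (hKb : ∀ z ∈ K, (b : WithTop ℝ≥0) < swallowingTime W z) :
    ∀ᶠ n in l, Disjoint K (hull (Wn n) b) := by
  filter_upwards [eventually_forall_lt_swallowingTime_of_tendstoUniformlyOn_driving hW hWn hconv hK hKb]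
    with n hn
  rw [Set.disjoint_left]
  intro z hz hzh
  exact (not_le.2 (hn z hz)) hzh.2

/-- **Kemppainen–Smirnov, Lemma 5.4 (uniform convergence of the Loewner maps).** If `W_n → W`
uniformly on `[0, b]` along a filter (all continuous) and `K` is a compact set of points flowing
beyond `b` for `W`, then `(s, z) ↦ g^{W_n}_s(z)` converges to `(s, z) ↦ g^{W}_s(z)` uniformly
on `[0, b] × K`. [cite: KemppainenSmirnov2017, App. A, Lemma 5.4]
[cite: Lawler2005, §4.7 Prop. 4.47] -/
theorem tendstoUniformlyOn_map_of_tendstoUniformlyOn_driving (hW : Continuous W)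
    (hWn : ∀ᶠ n in l, Continuous (Wn n))
    (hconv : TendstoUniformlyOn (fun n (s : ℝ≥0) ↦ Wn n s) W l (Iic b))
    (hK : IsCompact K) (hKb : ∀ z ∈ K, (b : WithTop ℝ≥0) < swallowingTime W z) :
    TendstoUniformlyOn (fun n (p : ℝ≥0 × ℂ) ↦ map (Wn n) p.1 p.2) (fun p ↦ map W p.1 p.2) l
      (Iic b ×ˢ K) := by
  rw [Metric.tendstoUniformlyOn_iff]
  intro ε hε
  obtain ⟨η, hη, hgood⟩ := exists_forall_dist_map_le_of_driving_close hW hK hKb (half_pos hε)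
  have h1 := (Metric.tendstoUniformlyOn_iff.1 hconv) η hη
  filter_upwards [hWn, h1] with n hn hn'
  rintro ⟨s, z⟩ ⟨hs, hz⟩
  have hWW' : ∀ s : ℝ≥0, s ≤ b → |W s - Wn n s| ≤ η := fun s hs ↦ by
    have := hn' s hs
    rw [Real.dist_eq] at this
    exact this.le
  have h2 := (hgood (Wn n) hn hWW' z hz).2 s hs
  rw [dist_comm]
  exact lt_of_le_of_lt h2 (half_lt_self hε)

/-- The same, at a fixed time `s ≤ b`: `g^{W_n}_s → g^{W}_s` uniformly on `K`.
[cite: KemppainenSmirnov2017, App. A, Lemma 5.4] -/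
theorem tendstoUniformlyOn_map_of_tendstoUniformlyOn_driving_of_le (hW : Continuous W)
    (hWn : ∀ᶠ n in l, Continuous (Wn n))
    (hconv : TendstoUniformlyOn (fun n (s : ℝ≥0) ↦ Wn n s) W l (Iic b))
    (hK : IsCompact K) (hKb : ∀ z ∈ K, (b : WithTop ℝ≥0) < swallowingTime W z) {s : ℝ≥0}
    (hs : s ≤ b) :
    TendstoUniformlyOn (fun n z ↦ map (Wn n) s z) (fun z ↦ map W s z) l K := by
  have h := tendstoUniformlyOn_map_of_tendstoUniformlyOn_driving hW hWn hconv hK hKb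
  rw [Metric.tendstoUniformlyOn_iff] at h ⊢
  intro ε hε
  filter_upwards [h ε hε] with n hn
  exact fun z hz ↦ hn (s, z) ⟨hs, hz⟩

/-- **Kemppainen–Smirnov, Lemma 5.4 (locally uniform form).** If `W_n → W` uniformly on
`[0, b]`, then for every `s ≤ b` the maps `g^{W_n}_s` converge to `g^{W}_s` locally uniformly on
the open set `{z | b < T_z^{W}}` of points flowing beyond `b` (real points included).
[cite: KemppainenSmirnov2017, App. A, Lemma 5.4] -/
theorem tendstoLocallyUniformlyOn_map_of_tendstoUniformlyOn_driving (hW : Continuous W)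
    (hWn : ∀ᶠ n in l, Continuous (Wn n))
    (hconv : TendstoUniformlyOn (fun n (s : ℝ≥0) ↦ Wn n s) W l (Iic b)) {s : ℝ≥0} (hs : s ≤ b) :
    TendstoLocallyUniformlyOn (fun n z ↦ map (Wn n) s z) (fun z ↦ map W s z) l
      {z : ℂ | (b : WithTop ℝ≥0) < swallowingTime W z} := by
  rw [tendstoLocallyUniformlyOn_iff_forall_isCompact (isOpen_setOf_lt_swallowingTime hW b)]
  intro K hKsub hK
  exact tendstoUniformlyOn_map_of_tendstoUniformlyOn_driving_of_le hW hWn hconv hK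
    (fun z hz ↦ hKsub hz) hs

end Tendsto

end Loewner

end Literature.Probability.RandomPlanarGeometry

end
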